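import Mathlib

/-!
# Order-3 surgery for `MomentParity.QuarticGate` (stmt-AnomalousDissipation-11464), helper I-a:
# the uniform cube as a strictly positive reference law ("FattenCube")

Support file for the stub `stub_order3Surgery` of the line `recession-cone` (S5), first half of
the FATTENING step (the lead's correction: an atomic order-2 design is never Slater, so before the
order-3 surgery the law is replaced by one with the same mean and covariance that charges every
nonzero nonnegative polynomial). Torus-free facts about the reference law
`U₀ = ρ^{⊗n}`, `ρ = ½·Lebesgue|[-1,1]` on `ℝⁿ = Fin n → ℝ` (written out, no definitions):
`ρ` is a probability measure with `∫ t dρ = 0`, `∫ t² dρ = 1/3`; the coordinates of `U₀` have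
mean `0` and second moments `δᵢⱼ/3`; `U₀` is carried by the cube, integrates every continuous
function, equals `2⁻ⁿ·Lebesgue|cube`, and gives positive mass to every open set meeting the open
cube; hence (identity theorem for real-analytic functions, in particular polynomials composed with
affine maps) `∫ q dU₀ > 0` for every analytic `q ≥ 0`, `q ≢ 0`. Plus the list of exponents of
degree `≤ 2`.
-/

-- `Summit.<Summit>.<Problem>` is the tree's mandated summit-side namespace (CONVENTIONS §2); for this
-- single-conjunct summit the two coincide, so the duplicate is deliberate.
set_option linter.dupNamespace false

namespace Summit.AnomalousDissipation.AnomalousDissipation.Theorems.MomentParityQuarticGate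

open scoped BigOperators ENNReal Topology
open MeasureTheory Set Filter

/-! ## The uniform probability measure `ρ` on `[-1,1]` -/

/-- `ρ = ½·Lebesgue|[-1,1]` is a probability measure. [folklore] -/
theorem isProbabilityMeasure_uniformIcc (ρ : Measure ℝ)
    (hρ : ρ = (2 : ℝ≥0∞)⁻¹ • (volume.restrict (Set.Icc (-1 : ℝ) 1))) : IsProbabilityMeasure ρ := by
  refine ⟨?_⟩
  rw [hρ, Measure.smul_apply, Measure.restrict_apply MeasurableSet.univ, Set.univ_inter,
    Real.volume_Icc, smul_eq_mul, show (1 : ℝ) - -1 = 2 by norm_num, ENNReal.ofReal_ofNat]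
  exact ENNReal.inv_mul_cancel (by norm_num) (by simp)

/-- `ρ([-1,1]) = 1`. [folklore] -/
theorem uniformIcc_Icc (ρ : Measure ℝ)
    (hρ : ρ = (2 : ℝ≥0∞)⁻¹ • (volume.restrict (Set.Icc (-1 : ℝ) 1))) : ρ (Set.Icc (-1) 1) = 1 := by
  rw [hρ, Measure.smul_apply, Measure.restrict_apply measurableSet_Icc, Set.inter_self,
    Real.volume_Icc, smul_eq_mul, show (1 : ℝ) - -1 = 2 by norm_num, ENNReal.ofReal_ofNat]
  exact ENNReal.inv_mul_cancel (by norm_num) (by simp)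

/-- Integration against `ρ` is `½ ∫_{-1}^{1}`. [folklore] -/
theorem integral_uniformIcc (ρ : Measure ℝ)
    (hρ : ρ = (2 : ℝ≥0∞)⁻¹ • (volume.restrict (Set.Icc (-1 : ℝ) 1))) (f : ℝ → ℝ) :
    ∫ t, f t ∂ρ = 2⁻¹ * ∫ t in (-1 : ℝ)..1, f t := by
  rw [hρ, integral_smul_measure, integral_Icc_eq_integral_Ioc,
    ← intervalIntegral.integral_of_le (by norm_num), smul_eq_mul, ENNReal.toReal_inv]
  norm_num

/-- `ρ` is centred: `∫ t dρ = 0`. [folklore] -/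
theorem integral_id_uniformIcc (ρ : Measure ℝ)
    (hρ : ρ = (2 : ℝ≥0∞)⁻¹ • (volume.restrict (Set.Icc (-1 : ℝ) 1))) : ∫ t, t ∂ρ = 0 := by
  rw [integral_uniformIcc ρ hρ, integral_id]
  norm_num

/-- Variance of `ρ`: `∫ t² dρ = 1/3`. [folklore] -/
theorem integral_mul_self_uniformIcc (ρ : Measure ℝ)
    (hρ : ρ = (2 : ℝ≥0∞)⁻¹ • (volume.restrict (Set.Icc (-1 : ℝ) 1))) : ∫ t, t * t ∂ρ = 1 / 3 := by
  rw [integral_uniformIcc ρ hρ]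
  simp_rw [← pow_two]
  rw [integral_pow]
  norm_num

/-! ## The product law `U₀ = ρ^{⊗n}` on `ℝⁿ` -/

/-- Mixed second moments of the coordinates under `U₀ = ρ^{⊗n}`: `∫ zᵢ zⱼ dU₀ = δᵢⱼ/3`
(independence = Fubini for product integrands). [folklore] -/
theorem integral_coord_mul_coord_pi (ρ : Measure ℝ)
    (hρ : ρ = (2 : ℝ≥0∞)⁻¹ • (volume.restrict (Set.Icc (-1 : ℝ) 1))) (n : ℕ) (i j : Fin n) :
    ∫ z, z i * z j ∂(Measure.pi fun _ : Fin n => ρ) = if i = j then 1 / 3 else 0 := by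
  classical
  haveI := isProbabilityMeasure_uniformIcc ρ hρ
  have hf : ∀ z : Fin n → ℝ, z i * z j =
      ∏ k, ((if k = i then z k else 1) * (if k = j then z k else 1)) := fun z => by
    rw [Finset.prod_mul_distrib, Finset.prod_ite_eq', Finset.prod_ite_eq']
    simp
  simp_rw [hf]
  rw [integral_fintype_prod_eq_prod
    (f := fun (k : Fin n) (t : ℝ) => (if k = i then t else 1) * (if k = j then t else 1))]
  have hk : ∀ k : Fin n, ∫ t, (if k = i then t else 1) * (if k = j then t else 1) ∂ρ =
      if k = i then (if k = j then 1 / 3 else 0) else (if k = j then 0 else 1) := fun k => by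
    split_ifs with hki hkj hkj
    · exact integral_mul_self_uniformIcc ρ hρ
    · simp_rw [mul_one]
      exact integral_id_uniformIcc ρ hρ
    · simp_rw [one_mul]
      exact integral_id_uniformIcc ρ hρ
    · simp
  simp_rw [hk]
  by_cases hij : i = j
  · subst hij
    rw [if_pos rfl]
    have e : (fun k : Fin n => if k = i then (if k = i then (1 : ℝ) / 3 else 0)
        else (if k = i then 0 else 1)) = fun k => if k = i then 1 / 3 else 1 := by
      funext k
      split_ifs <;> rfl
    rw [e, Finset.prod_ite_eq']
    simp
  · rw [if_neg hij]
    exact Finset.prod_eq_zero (Finset.mem_univ i) (by simp [hij])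

/-- The coordinates are centred under `U₀`: `∫ zᵢ dU₀ = 0`. [folklore] -/
theorem integral_coord_pi (ρ : Measure ℝ)
    (hρ : ρ = (2 : ℝ≥0∞)⁻¹ • (volume.restrict (Set.Icc (-1 : ℝ) 1))) (n : ℕ) (i : Fin n) :
    ∫ z, z i ∂(Measure.pi fun _ : Fin n => ρ) = 0 := by
  classical
  haveI := isProbabilityMeasure_uniformIcc ρ hρ
  have hf : ∀ z : Fin n → ℝ, z i = ∏ k, (if k = i then z k else 1) := fun z => by
    rw [Finset.prod_ite_eq']
    simp
  simp_rw [hf]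
  rw [integral_fintype_prod_eq_prod (f := fun (k : Fin n) (t : ℝ) => if k = i then t else 1)]
  exact Finset.prod_eq_zero (Finset.mem_univ i) (by simp [integral_id_uniformIcc ρ hρ])

/-- `U₀` is carried by the cube `[-1,1]ⁿ`. [folklore] -/
theorem ae_mem_Icc_pi (ρ : Measure ℝ)
    (hρ : ρ = (2 : ℝ≥0∞)⁻¹ • (volume.restrict (Set.Icc (-1 : ℝ) 1))) (n : ℕ) :
    ∀ᵐ z ∂(Measure.pi fun _ : Fin n => ρ), z ∈ Set.Icc (-1 : Fin n → ℝ) 1 := by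
  haveI := isProbabilityMeasure_uniformIcc ρ hρ
  have h1 : (Measure.pi fun _ : Fin n => ρ) (Set.Icc (-1 : Fin n → ℝ) 1) = 1 := by
    rw [← Set.pi_univ_Icc, Measure.pi_pi]
    simp [uniformIcc_Icc ρ hρ]
  have h0 := (prob_compl_eq_zero_iff measurableSet_Icc).mpr h1
  rw [ae_iff]
  exact h0

/-- Every continuous function is `U₀`-integrable (bounded on the compact carrier). [folklore] -/
theorem integrable_pi_of_continuous (ρ : Measure ℝ)
    (hρ : ρ = (2 : ℝ≥0∞)⁻¹ • (volume.restrict (Set.Icc (-1 : ℝ) 1))) (n : ℕ)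
    {g : (Fin n → ℝ) → ℝ} (hg : Continuous g) : Integrable g (Measure.pi fun _ : Fin n => ρ) := by
  haveI := isProbabilityMeasure_uniformIcc ρ hρ
  obtain ⟨C, hC⟩ := (isCompact_Icc : IsCompact (Set.Icc (-1 : Fin n → ℝ) 1)).exists_bound_of_continuousOn
    hg.continuousOn
  exact Integrable.of_bound hg.aestronglyMeasurable C ((ae_mem_Icc_pi ρ hρ n).mono fun z hz => hC z hz)

/-- `U₀ = 2⁻ⁿ · Lebesgue|[-1,1]ⁿ`. [folklore] -/
theorem pi_uniformIcc_eq (ρ : Measure ℝ)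
    (hρ : ρ = (2 : ℝ≥0∞)⁻¹ • (volume.restrict (Set.Icc (-1 : ℝ) 1))) (n : ℕ) :
    (Measure.pi fun _ : Fin n => ρ) =
      ((2 : ℝ≥0∞)⁻¹) ^ n • (volume : Measure (Fin n → ℝ)).restrict (Set.Icc (-1) 1) := by
  haveI := isProbabilityMeasure_uniformIcc ρ hρ
  refine Measure.pi_eq fun s hs => ?_
  rw [Measure.smul_apply, Measure.restrict_apply (MeasurableSet.univ_pi hs), ← Set.pi_univ_Icc,
    ← Set.pi_inter_distrib, volume_pi_pi, smul_eq_mul]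
  have : ∀ i : Fin n, ρ (s i) = 2⁻¹ * volume (s i ∩ Set.Icc (-1 : ℝ) 1) := fun i => by
    rw [hρ, Measure.smul_apply, Measure.restrict_apply (hs i), smul_eq_mul]
  simp_rw [this]
  rw [Finset.prod_mul_distrib, Finset.prod_const, Finset.card_univ, Fintype.card_fin]
  rfl

/-- `U₀` charges every open set meeting the open cube `(-1,1)ⁿ`. [folklore] -/
theorem measure_pi_pos_of_isOpen (ρ : Measure ℝ)
    (hρ : ρ = (2 : ℝ≥0∞)⁻¹ • (volume.restrict (Set.Icc (-1 : ℝ) 1))) (n : ℕ)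
    {O : Set (Fin n → ℝ)} (hO : IsOpen O)
    (hne : (O ∩ Set.pi Set.univ fun _ : Fin n => Set.Ioo (-1 : ℝ) 1).Nonempty) :
    0 < (Measure.pi fun _ : Fin n => ρ) O := by
  have hopen : IsOpen (O ∩ Set.pi Set.univ fun _ : Fin n => Set.Ioo (-1 : ℝ) 1) :=
    hO.inter (isOpen_set_pi Set.finite_univ fun _ _ => isOpen_Ioo)
  have hsub : (O ∩ Set.pi Set.univ fun _ : Fin n => Set.Ioo (-1 : ℝ) 1) ⊆ Set.Icc (-1) 1 := by
    rw [← Set.pi_univ_Icc]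
    exact Set.inter_subset_right.trans (Set.pi_mono fun _ _ => Set.Ioo_subset_Icc_self)
  refine lt_of_lt_of_le ?_ (measure_mono
    (Set.inter_subset_left (s := O) (t := Set.pi Set.univ fun _ : Fin n => Set.Ioo (-1 : ℝ) 1)))
  rw [pi_uniformIcc_eq ρ hρ n, Measure.smul_apply, Measure.restrict_apply hopen.measurableSet,
    Set.inter_eq_left.mpr hsub, smul_eq_mul]
  exact ENNReal.mul_pos (pow_ne_zero _ (by simp)) (hopen.measure_pos volume hne).ne'

/-! ## Analytic (in particular polynomial) integrands -/

/-- A polynomial in analytic coordinate functions is analytic; e.g. `z ↦ p(M + Bz)`. [folklore] -/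
theorem analyticOnNhd_eval_comp {n m : ℕ} (p : MvPolynomial (Fin m) ℝ)
    {T : (Fin n → ℝ) → (Fin m → ℝ)} (hT : ∀ i, AnalyticOnNhd ℝ (fun z => T z i) Set.univ) :
    AnalyticOnNhd ℝ (fun z => MvPolynomial.eval (T z) p) Set.univ := by
  induction p using MvPolynomial.induction_on with
  | C a => simpa using (analyticOnNhd_const : AnalyticOnNhd ℝ (fun _ : Fin n → ℝ => a) Set.univ)
  | add p q hp hq =>
    have e : (fun z => MvPolynomial.eval (T z) (p + q)) =
        (fun z => MvPolynomial.eval (T z) p) + fun z => MvPolynomial.eval (T z) q := by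
      funext z
      simp
    rw [e]
    exact hp.add hq
  | mul_X p i hp =>
    have e : (fun z => MvPolynomial.eval (T z) (p * MvPolynomial.X i)) =
        fun z => MvPolynomial.eval (T z) p * T z i := by
      funext z
      simp
    rw [e]
    exact hp.mul (hT i)

/-- The coordinates of an affine map `z ↦ M + Bz` are analytic. [folklore] -/
theorem analyticOnNhd_affine_coord {n : ℕ} (M : Fin n → ℝ) (B : Matrix (Fin n) (Fin n) ℝ)
    (i : Fin n) : AnalyticOnNhd ℝ (fun z : Fin n → ℝ => (M + B.mulVec z) i) Set.univ := by
  have hL : AnalyticOnNhd ℝ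
      (fun z : Fin n → ℝ => ((ContinuousLinearMap.proj i).comp
        (LinearMap.toContinuousLinearMap (Matrix.mulVecLin B))) z) Set.univ :=
    ContinuousLinearMap.analyticOnNhd _ _
  have e : (fun z : Fin n → ℝ => (M + B.mulVec z) i) = (fun _ => M i) + fun z : Fin n → ℝ =>
      ((ContinuousLinearMap.proj i).comp (LinearMap.toContinuousLinearMap (Matrix.mulVecLin B))) z := by
    funext z
    simp
  rw [e]
  exact (analyticOnNhd_const (v := M i)).add hL

/-- Identity theorem: an analytic function on `ℝⁿ` vanishing on a nonempty open set vanishes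
identically. [folklore] -/
theorem eq_zero_of_eqOn_isOpen {n : ℕ} {q : (Fin n → ℝ) → ℝ} (hq : AnalyticOnNhd ℝ q Set.univ)
    {U : Set (Fin n → ℝ)} (hU : IsOpen U) (hne : U.Nonempty) (h : ∀ z ∈ U, q z = 0) (z : Fin n → ℝ) :
    q z = 0 := by
  obtain ⟨z₀, hz₀⟩ := hne
  have hev : q =ᶠ[𝓝 z₀] 0 := Filter.eventuallyEq_of_mem (hU.mem_nhds hz₀) fun z hz => h z hz
  exact hq.eqOn_zero_of_preconnected_of_eventuallyEq_zero isPreconnected_univ (Set.mem_univ z₀) hev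
    (Set.mem_univ z)

/-- **Strict positivity of the cube law.** For an analytic `q ≥ 0` on `ℝⁿ` that does not vanish
identically, `∫ q dU₀ > 0`: the open set `{q > 0}` meets the open cube (else `q ≡ 0` by the
identity theorem), and `U₀` charges it. [folklore] -/
theorem integral_pi_pos :
    ∀ (ρ : MeasureTheory.Measure ℝ), ρ = (2 : ENNReal)⁻¹ • (MeasureTheory.volume.restrict (Set.Icc
      (-1 : ℝ) 1)) → ∀ (n : ℕ) {q : (Fin n → ℝ) → ℝ}, AnalyticOnNhd ℝ q Set.univ → (∀ z, 0 ≤ q z) →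
      (∃ z, q z ≠ 0) → 0 < ∫ z, q z ∂(MeasureTheory.Measure.pi fun _ : Fin n => ρ) := by
  intro ρ hρ n q hq hnn hne
  have hcont : Continuous q := continuousOn_univ.mp hq.continuousOn
  rw [integral_pos_iff_support_of_nonneg hnn (integrable_pi_of_continuous ρ hρ n hcont)]
  by_cases hmeet : (Function.support q ∩ Set.pi Set.univ fun _ : Fin n => Set.Ioo (-1 : ℝ) 1).Nonempty
  · exact measure_pi_pos_of_isOpen ρ hρ n (hcont.isOpen_support) hmeet
  · exfalso
    obtain ⟨z₁, hz₁⟩ := hne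
    have h0 : (0 : Fin n → ℝ) ∈ Set.pi Set.univ (fun _ : Fin n => Set.Ioo (-1 : ℝ) 1) :=
      Set.mem_univ_pi.mpr fun i => by norm_num
    refine hz₁ (eq_zero_of_eqOn_isOpen hq (isOpen_set_pi Set.finite_univ fun _ _ => isOpen_Ioo)
      ⟨0, h0⟩ (fun z hz => ?_) z₁)
    by_contra hqz
    exact hmeet ⟨z, Function.mem_support.mpr hqz, hz⟩

/-! ## Exponents of degree `≤ 2` -/

/-- An exponent of degree `d + 1` splits off a unit vector. [folklore] -/
theorem exists_single_add_of_degree_eq_succ {n : ℕ} (α : Fin n →₀ ℕ) (d : ℕ)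
    (h : α.degree = d + 1) : ∃ (i : Fin n) (β : Fin n →₀ ℕ), α = Finsupp.single i 1 + β ∧ β.degree = d := by
  have hα : α ≠ 0 := by
    intro h0
    rw [h0, map_zero] at h
    exact Nat.succ_ne_zero d h.symm
  obtain ⟨i, hi⟩ : ∃ i, α i ≠ 0 := by
    by_contra hall
    push Not at hall
    exact hα (Finsupp.ext fun i => by simpa using hall i)
  have hle : Finsupp.single i 1 ≤ α := Finsupp.single_le_iff.mpr (Nat.one_le_iff_ne_zero.mpr hi)
  refine ⟨i, α - Finsupp.single i 1, (add_tsub_cancel_of_le hle).symm, ?_⟩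
  have hdeg := congr_arg Finsupp.degree (add_tsub_cancel_of_le hle)
  rw [map_add, Finsupp.degree_single, h] at hdeg
  omega

/-- The exponents of degree `≤ 2` are `0`, `eᵢ`, `eᵢ + eⱼ`. [folklore] -/
theorem finsupp_degree_le_two {n : ℕ} (α : Fin n →₀ ℕ) (h : α.degree ≤ 2) :
    α = 0 ∨ (∃ i, α = Finsupp.single i 1) ∨ ∃ i j, α = Finsupp.single i 1 + Finsupp.single j 1 := by
  rcases Nat.lt_or_ge α.degree 1 with h0 | h1
  · left
    exact (Finsupp.degree_eq_zero_iff α).mp (by omega)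
  · right
    rcases Nat.lt_or_ge α.degree 2 with h1' | h2
    · obtain ⟨i, β, rfl, hβ⟩ := exists_single_add_of_degree_eq_succ α 0 (by omega)
      left
      refine ⟨i, ?_⟩
      rw [(Finsupp.degree_eq_zero_iff β).mp hβ, add_zero]
    · obtain ⟨i, β, rfl, hβ⟩ := exists_single_add_of_degree_eq_succ α 1 (by omega)
      obtain ⟨j, γ, rfl, hγ⟩ := exists_single_add_of_degree_eq_succ β 0 hβ
      right
      refine ⟨i, j, ?_⟩
      rw [(Finsupp.degree_eq_zero_iff γ).mp hγ, add_zero]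

end Summit.AnomalousDissipation.AnomalousDissipation.Theorems.MomentParityQuarticGate
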